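import Literature.NumberTheory.GaloisRepresentations.LubinTateComparisonReflectionTwo
import HarnessLib

/-!
# `ϑ` and the `𝒪_F`-action: `(h ∘ [a]_{f'}) ∘ ϑ = (h ∘ ϑ) ∘ [a]_f`, and at `q = 2` the endomorphisms
# `[a]_{f₀}` of `f₀ = 2X + X²` are the binomial series `(1+X)^a − 1` (the dilations of the measure side)

Topic `NumberTheory/GaloisRepresentations`; namespace `Literature.NumberTheory.GaloisRepresentations`.

De Shalit, *Iwasawa theory of elliptic curves with complex multiplication* (1987), I.3.4 Lemma (ii) and II.4.5
(iv)–4.6: the measure of `σβ` is the dilation of the measure of `β` by `κ(σ)`, because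
`g_{σβ} = g_β ∘ [κσ]_{f'}` and, read on `Ĝ_m` through `θ`, `[a]_{f'}` becomes `[a]_{Ĝ_m} = (1+S)^a − 1`
(tree `invAmice₁_binomDilate_μ`, `binomDilate_eq_subst`: `D_{H((1+S)^u − 1)} = u_* D_H`).  This file supplies
the two series identities of that transport for the concrete comparison series `ϑ = compSeriesC hπ hσ₀ u hε`
(`f = πX + X^q → f' = π'X + X^q`, `π' = uπ`, `LubinTateComparisonPoints.lean`):

* ★ `LubinTate.map_hom` — `[a]_{f,g}` read through a ring map `φ` is
  `[φ a]_{φf, φg}` (uniqueness in Lubin–Tate's lemma); `LubinTate.hom_congr`;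
* `subst_homC_compSeriesC` — the series identity `ϑ ∘ [a]_f = [a]_{f'} ∘ ϑ` on the discrete copy of
  `𝒪̂_{F^nr}` (tree `subst_hom_ltComparison`, Lubin–Tate (18));
* ★★ `subst_compSeriesC_subst_homC'` — **`(h ∘ [a]_{f'}) ∘ ϑ = (h ∘ ϑ) ∘ [a]_f`** for every `h ∈ 𝒪̂_{F^nr}⟦X⟧`
  (any `q`): the `𝒪_F`-action on Coleman series goes to the `𝒪_F`-action on `Ĝ_m`-series;
* ★★ `map_hom_ltPoly_two_eq_binomialSeries_sub_one` — at `|𝓀_F| = 2` with `2` a uniformiser, for every ring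
  map `e : 𝒪[F] → ℤ_2`: **`e([a]_{f₀}) = (1+X)^{e a} − 1`** (Mathlib `PowerSeries.binomialSeries`; tree
  `hom_one_add_X_pow_sub_one`), i.e. the transported action IS the dilation `binomDilate (e a)` of the measure side.

Everything is proved; no named facts, no definitions, no instances, no `sorry`.

## References

* [deShalit1987] E. de Shalit, *Iwasawa theory of elliptic curves with complex multiplication* (1987),
  I.3.4 Lemma (ii) (p. 18), II.4.5 (iv), II.4.6 (p. 59).
* [LubinTate1965] J. Lubin, J. Tate, *Formal complex multiplication in local fields*, Ann. of Math. 81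
  (1965), §1 Thm. 1 (9), Lemma p. 385 (18).
* [CasselsFrohlichANT1967] J.-P. Serre, *Local class field theory*, Ch. VI §3.3 Example (b), §3.5 Prop. 2.
-/

noncomputable section

open MvPowerSeries

namespace Literature.NumberTheory.GaloisRepresentations

namespace LubinTate

/-! ### `[a]_{f,g}` under a change of coefficient ring -/

section MapHom

variable {A : Type*} [CommRing A] {B : Type*} [CommRing B]

/-- ★ **`φ([a]_{f,g}) = [φ a]_{φf, φg}`**: the Lubin–Tate endomorphism series commute with a change of
coefficient ring (both sides solve `φf ∘ H = H ∘ φg`, `H ≡ φ(a)X`). [cite: CasselsFrohlichANT1967, Ch. VI §3.5 Prop. 2] -/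
theorem map_hom (φ : A →+* B) {π : A} {q : ℕ} (hA : IsLTRing π q) {f g : PowerSeries A}
    (hf : IsLTSeries π q f) (hg : IsLTSeries π q g) {π' : B} {q' : ℕ} (hB : IsLTRing π' q')
    (hf' : IsLTSeries π' q' (f.map φ)) (hg' : IsLTSeries π' q' (g.map φ)) (a : A) :
    (hom hA hf hg a).map φ = hom hB hf' hg' (φ a) := by
  refine eq_hom hB hf' hg' ?_ ?_ ?_
  · rw [← PowerSeries.coeff_zero_eq_constantCoeff_apply, PowerSeries.coeff_map,
      PowerSeries.coeff_zero_eq_constantCoeff_apply, constantCoeff_hom, map_zero]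
  · rw [PowerSeries.coeff_map, coeff_one_hom]
  · have h := congrArg (PowerSeries.map φ) (subst_hom hA hf hg a)
    erw [PowerSeries.map_subst (PowerSeries.HasSubst.of_constantCoeff_zero' (constantCoeff_hom hA hf hg a)),
      PowerSeries.map_subst (PowerSeries.HasSubst.of_constantCoeff_zero' hg.constantCoeff_eq_zero)] at h
    exact h

/-- `[a]_{f,g}` only depends on the series `f, g` and on `a` (not on `π`, `q` or the proofs).
[cite: CasselsFrohlichANT1967, Ch. VI §3.5 Prop. 2] -/
theorem hom_congr {π π' : A} {q q' : ℕ} (hA : IsLTRing π q) (hA' : IsLTRing π' q') {f g f₁ g₁ : PowerSeries A}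
    (hf : IsLTSeries π q f) (hg : IsLTSeries π q g) (hf₁ : IsLTSeries π' q' f₁) (hg₁ : IsLTSeries π' q' g₁)
    (hff : f = f₁) (hgg : g = g₁) (a : A) : hom hA hf hg a = hom hA' hf₁ hg₁ a := by
  subst hff hgg
  exact eq_hom hA' hf₁ hg₁ (constantCoeff_hom hA hf hg a) (coeff_one_hom hA hf hg a) (subst_hom hA hf hg a)

end MapHom

end LubinTate

/-! ### `(h ∘ [a]_{f'}) ∘ ϑ = (h ∘ ϑ) ∘ [a]_f` -/

section ComparisonDilation

open ValuativeRel IsLocalRing Field IsNonarchimedeanLocalField LubinTate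
open Literature.NumberTheory.PAdicHodge

variable {F : Type} [Field F] [ValuativeRel F] [TopologicalSpace F] [IsNonarchimedeanLocalField F]
variable {π : 𝒪[F]} (hπ : (valuation F).IsUniformizer (π : F))
  {σ₀ : absoluteGaloisGroup F} (hσ₀ : IsAbsArithFrob σ₀) (u : 𝒪[F]ˣ)
  {ε : (maxUnramifiedCompletion F)ˣ}
  (hε : maxUnramifiedCompletion.galAut F σ₀ (ε : maxUnramifiedCompletion F) =
    algebraMap 𝒪[F] (maxUnramifiedCompletion F) (u : 𝒪[F]) * (ε : maxUnramifiedCompletion F))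

/-- **`ϑ ∘ [a]_f = [a]_{f'} ∘ ϑ`** as series over the discrete copy of `𝒪̂_{F^nr}` (tree
`subst_hom_ltComparison` transported; Lubin–Tate (18)). [cite: LubinTate1965, Lemma p. 385, (18)] -/
theorem subst_homC_compSeriesC (a : 𝒪[F]) :
    PowerSeries.subst (homC hπ a) (compSeriesC hπ hσ₀ u hε) =
      PowerSeries.subst (compSeriesC hπ hσ₀ u hε) (homC' hπ u a) := by
  have h := congrArg (PowerSeries.map (UnrCoeff.of F).toRingHom) (subst_hom_ltComparison hπ hσ₀ u hε a)
  have hs1 : PowerSeries.HasSubst ((hom (isLTRing_integer F hπ) (isLTSeries_ltPoly F) (isLTSeries_ltPoly F) a).map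
      (algebraMap 𝒪[F] (maxUnramifiedCompletion F))) :=
    PowerSeries.HasSubst.of_constantCoeff_zero' (constantCoeff_map_hom _ _ _ a)
  have hs2 : PowerSeries.HasSubst (ltComparison hπ hσ₀ u hε) :=
    PowerSeries.HasSubst.of_constantCoeff_zero' (constantCoeff_ltComparison hπ hσ₀ u hε)
  erw [PowerSeries.map_subst hs1, PowerSeries.map_subst hs2] at h
  rw [compSeriesC, homC, homC', intToUnrCoeff, PowerSeries.map_comp, RingHom.comp_apply, RingHom.comp_apply]
  exact h

/-- ★★ **`(h ∘ [a]_{f'}) ∘ ϑ = (h ∘ ϑ) ∘ [a]_f`** for every `h ∈ 𝒪̂_{F^nr}⟦X⟧` and `a ∈ 𝒪_F`: the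
`𝒪_F`-action on series for `F_{f'}` (Coleman: `g_{σβ} = g_β ∘ [κσ]_{f'}`) is carried by `ϑ` to the
`𝒪_F`-action on series for `F_f` (`Ĝ_m` at `q = 2`: the dilations of the measure side).
[cite: deShalit1987, I.3.4 Lemma (ii) (p. 18)] -/
theorem subst_compSeriesC_subst_homC' (a : 𝒪[F]) (h : PowerSeries (UnrCoeff F)) :
    PowerSeries.subst (compSeriesC hπ hσ₀ u hε) (PowerSeries.subst (homC' hπ u a) h) =
      PowerSeries.subst (homC hπ a) (PowerSeries.subst (compSeriesC hπ hσ₀ u hε) h) := by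
  have hsθ : PowerSeries.HasSubst (compSeriesC hπ hσ₀ u hε) :=
    PowerSeries.HasSubst.of_constantCoeff_zero' (constantCoeff_compSeriesC hπ hσ₀ u hε)
  have hs' : PowerSeries.HasSubst (homC' hπ u a) := PowerSeries.HasSubst.of_constantCoeff_zero' (constantCoeff_homC' hπ u a)
  have hs : PowerSeries.HasSubst (homC hπ a) := PowerSeries.HasSubst.of_constantCoeff_zero' (constantCoeff_homC hπ a)
  rw [PowerSeries.subst_comp_subst_apply hs' hsθ, PowerSeries.subst_comp_subst_apply hsθ hs,
    subst_homC_compSeriesC hπ hσ₀ u hε a]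

/-! ### `q = 2`: `[a]_{f₀} = (1+X)^a − 1` -/

/-- **At `|𝓀_F| = 2` with `2` a uniformiser, read in `ℤ_2` through ANY ring map `e : 𝒪[F] → ℤ_2`, the
endomorphism `[a]_{f₀}` of `f₀ = 2X + X²` is the binomial series `(1+X)^{e a} − 1`** — the inner series of the
measure side's `binomDilate (e a)` (tree `hom_one_add_X_pow_sub_one` over `ℤ_p`, `map_hom`).
[cite: deShalit1987, I.3.4 Lemma (ii) (p. 18)] -/
theorem map_hom_ltPoly_two_eq_binomialSeries_sub_one (hq : residueFieldCard F = 2)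
    (h2 : (valuation F).IsUniformizer (((2 : ℕ) : 𝒪[F]) : F)) (e : 𝒪[F] →+* ℤ_[2]) (a : 𝒪[F]) :
    (hom (isLTRing_integer F h2) (isLTSeries_ltPoly F (π := ((2 : ℕ) : 𝒪[F])))
        (isLTSeries_ltPoly F (π := ((2 : ℕ) : 𝒪[F]))) a).map e =
      PowerSeries.binomialSeries ℤ_[2] (e a) - 1 := by
  haveI : Fact (Nat.Prime 2) := ⟨Nat.prime_two⟩
  -- the image of `f₀` is `(1+X)² − 1`
  have hf : (((ltPoly F ((2 : ℕ) : 𝒪[F]) : Polynomial 𝒪[F]) : PowerSeries 𝒪[F])).map e =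
      (1 + PowerSeries.X : PowerSeries ℤ_[2]) ^ 2 - 1 := by
    rw [coe_ltPoly_two_eq hq, map_sub, map_pow, map_add, map_one, PowerSeries.map_X]
  have hA : IsLTRing (e ((2 : ℕ) : 𝒪[F])) 2 := by rw [map_natCast]; exact PadicInt.isLTRing 2
  have hf' : IsLTSeries (e ((2 : ℕ) : 𝒪[F])) 2
      ((((ltPoly F ((2 : ℕ) : 𝒪[F]) : Polynomial 𝒪[F]) : PowerSeries 𝒪[F])).map e) := by
    rw [hf, map_natCast]; exact isLTSeries_one_add_X_pow_sub_one 2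
  rw [map_hom e (isLTRing_integer F h2) (isLTSeries_ltPoly F) (isLTSeries_ltPoly F) hA hf' hf' a,
    hom_congr hA (PadicInt.isLTRing 2) hf' hf' (isLTSeries_one_add_X_pow_sub_one 2)
      (isLTSeries_one_add_X_pow_sub_one 2) hf hf (e a), hom_one_add_X_pow_sub_one]

end ComparisonDilation

end Literature.NumberTheory.GaloisRepresentations

end
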